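import Summits.HodgeConjecture.HodgeConjecture.Theorems.Ring2WeilCoverageCMFieldNormDescent
import HarnessLib

/-!
# Non-split Weil-type components over quartic CM fields, IV: the obstruction at the TOTALLY RAMIFIED
# (Eisenstein) prime — the dyadic row `[2]` of `ℚ(ζ₅)`

research route conditional on HC_CM; not a corollary; Q11.4-sentence-2 already refuted in dim ≥ 3.
Cell `pub-hodge-ring2`, seat `ring2-b03` (gen 47); kernel certificates for the Weil-type family-coverage
census `HOME/WEIL-FAMILY-COVERAGE.md` §b03.5 (operator priority5 2026-08-22T11:46:08Z). The criteria of gens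
46–47 (`Ring2WeilCoverageCMField{NormDescent,Criteria,InertPrimes}`) decide a class `[ℓw]`, `ℓ ∤ w`, at an odd
prime `ℓ` UNRAMIFIED in `E` all of whose places are inert in `E/F`. For `E = ℚ(ζ₅)` (`R = S² + 5S + 5`,
`F = ℚ(√5)`) that leaves the dyadic class `[2]` (`T = {(2), (√5)}`; everything is a square in `𝔽₄`, so no
mod-2 anisotropy). This file decides it at the OTHER place of `T`: `R` is Eisenstein at `ℓ = 5`, `𝔭 = (√5)`
is totally ramified in `E`, `σ ≡ 0 (mod 𝔭)`, so `a² - σb² ≡ a² (mod 𝔭)` and a norm which is a `𝔭`-unit is a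
SQUARE mod `𝔭 = 𝔽₅`; `2` is not. §1 is the generic two-step `ℓ`-descent (`p = ℓp₁`, `q = ℓq₁`, `ℓ ∤ q₁`,
`c` a non-square unit mod `ℓ`: `X ≡ A²`, `Y ≡ -C²`, `X/ℓ ≡ -q₁B²`, `Y/ℓ ≡ q₁D²` mod `ℓ`), §2 the certificate
`mk_ne_splitDiscriminantClassCM_of_eisenstein`, §3 the instance: `[c] ≠ [1]` for every `c ≡ ±2 (mod 5)` —
rows `[2]`, `[3]`, `[7]`, `[8]`, …, `[27]`, …, `[38]` of the `ℚ(ζ₅)` table, and §4 `[5c] = [c]` (`5 = (2σ+5)²` is a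
norm): rows `[10]`, `[15]`, `[35]`, `[40]`. With gens 46–47 EVERY non-split class `n ≤ 40` of the `ℚ(ζ₅)` table
is now kernel-decided (as for the four `V₄` fields, `Ring2WeilCoverageCMFieldBiquadratic`).

No named fact, no definition, no `sorry`; nothing about the Hodge conjecture is asserted.
References: [Deligne1982HodgeCycles] §4 p. 30 (1), Cor. 4.2, Lemma 4.6; [Landherr1936HermitianForms]. -/

noncomputable section

set_option linter.dupNamespace false

open Polynomial

namespace Summit.HodgeConjecture.HodgeConjecture.Ring2.WeilCoverageCM

open Literature.AlgebraicGeometry.Deligne1982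
open Literature.AlgebraicGeometry.HodgeTheory (splitDiscriminantClassCM)

/-! ### §1 Descent at the TOTALLY RAMIFIED (Eisenstein) prime: `p = ℓp₁`, `q = ℓq₁`, `ℓ ∤ q₁` -/

/-- **Integer descent at the Eisenstein prime.** For `R = S² + pS + q` Eisenstein at the odd prime `ℓ`
(`p = ℓp₁`, `q = ℓq₁`, `ℓ ∤ q₁`; then `𝔭 = (ℓ, σ)` is the unique place of `F` over `ℓ`, `𝔭² = (ℓ)`, `σ ≡ 0 mod 𝔭`,
and `E = F(√σ)` is RAMIFIED at `𝔭`) and an integer `c` with `a² ≡ c·m² (mod ℓ) ⇒ a ≡ m ≡ 0` (`c` a non-square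
unit mod `ℓ`, i.e. `(c, σ)_𝔭 = -1`): the equations `X = cM²`, `Y = 0` (`X`, `Y` the coordinate forms of
`a² - σb²`, as in `descent_of_aniso`) force `M = 0`. The `𝔭`-adic descent is done in two `ℓ`-steps:
`X ≡ A² (ℓ)` gives `ℓ ∣ A, M`; then `Y ≡ -C² (ℓ)` gives `ℓ ∣ C`; then `X/ℓ ≡ -q₁B² (ℓ)` gives `ℓ ∣ B`; then
`Y/ℓ ≡ q₁D² (ℓ)` gives `ℓ ∣ D`; divide by `ℓ²`. [folklore] -/
theorem descent_of_eisenstein (p₁ q₁ c : ℤ) (ℓ : ℕ) (hℓ : ℓ.Prime) (hq₁ : ¬ (ℓ : ℤ) ∣ q₁)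
    (hc : ∀ a m : ZMod ℓ, a ^ 2 = (c : ZMod ℓ) * m ^ 2 → a = 0 ∧ m = 0) :
    ∀ (n : ℕ) (A B Cc D M : ℤ), M.natAbs ≤ n →
      A ^ 2 - (ℓ * q₁) * B ^ 2 + 2 * (ℓ * q₁) * Cc * D - (ℓ * p₁) * (ℓ * q₁) * D ^ 2 = c * M ^ 2 →
      2 * A * B - (ℓ * p₁) * B ^ 2 - Cc ^ 2 + 2 * (ℓ * p₁) * Cc * D - ((ℓ * p₁) ^ 2 - ℓ * q₁) * D ^ 2 = 0 →
        M = 0 := by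
  haveI : Fact ℓ.Prime := ⟨hℓ⟩
  have hℓp : Prime (ℓ : ℤ) := Nat.prime_iff_prime_int.1 hℓ
  have hℓ0 : (ℓ : ℤ) ≠ 0 := hℓp.ne_zero
  have hℓ2 : 2 ≤ ℓ := hℓ.two_le
  have hz : ((ℓ : ℕ) : ZMod ℓ) = 0 := ZMod.natCast_self ℓ
  have hq₁z : ((q₁ : ℤ) : ZMod ℓ) ≠ 0 := by
    rwa [Ne, ZMod.intCast_zmod_eq_zero_iff_dvd]
  have sq_zero : ∀ x : ZMod ℓ, x ^ 2 = 0 → x = 0 := fun x hx => pow_eq_zero_iff (n := 2) (by norm_num) |>.1 hx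
  intro n
  induction n with
  | zero => intro A B Cc D M h1 _ _; omega
  | succ n ih =>
    intro A B Cc D M h1 hX hY
    -- (i) `ℓ ∣ A`, `ℓ ∣ M`
    have hAM : ((A : ZMod ℓ)) = 0 ∧ ((M : ZMod ℓ)) = 0 := by
      apply hc
      have := congrArg (Int.cast : ℤ → ZMod ℓ) hX
      push_cast at this
      linear_combination this + ((q₁ : ZMod ℓ) * (B : ZMod ℓ) ^ 2 - 2 * (q₁ : ZMod ℓ) * (Cc : ZMod ℓ) * (D : ZMod ℓ)
        + (p₁ : ZMod ℓ) * ((ℓ : ℕ) : ZMod ℓ) * (q₁ : ZMod ℓ) * (D : ZMod ℓ) ^ 2) * hz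
    obtain ⟨hA, hM⟩ := hAM
    -- (ii) `ℓ ∣ C`
    have hC : ((Cc : ZMod ℓ)) = 0 := by
      have := congrArg (Int.cast : ℤ → ZMod ℓ) hY
      push_cast at this
      refine sq_zero _ ?_
      linear_combination -this + 2 * (B : ZMod ℓ) * hA
        + (-(p₁ : ZMod ℓ) * (B : ZMod ℓ) ^ 2 + 2 * (p₁ : ZMod ℓ) * (Cc : ZMod ℓ) * (D : ZMod ℓ)
            - ((ℓ : ℕ) : ZMod ℓ) * (p₁ : ZMod ℓ) ^ 2 * (D : ZMod ℓ) ^ 2 + (q₁ : ZMod ℓ) * (D : ZMod ℓ) ^ 2) * hz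
    rw [ZMod.intCast_zmod_eq_zero_iff_dvd] at hA hM hC
    obtain ⟨⟨A', rfl⟩, ⟨M', rfl⟩, ⟨C', rfl⟩⟩ := And.intro hA (And.intro hM hC)
    -- (iii) `X/ℓ`, then `ℓ ∣ B`
    have hX1 : (ℓ : ℤ) * A' ^ 2 - q₁ * B ^ 2 + 2 * (ℓ * q₁) * C' * D - p₁ * (ℓ * q₁) * D ^ 2
        - c * ℓ * M' ^ 2 = 0 := by
      have h : (ℓ : ℤ) * ((ℓ : ℤ) * A' ^ 2 - q₁ * B ^ 2 + 2 * (ℓ * q₁) * C' * D - p₁ * (ℓ * q₁) * D ^ 2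
          - c * ℓ * M' ^ 2) = 0 := by linear_combination hX
      exact (mul_eq_zero.1 h).resolve_left hℓ0
    have hB : ((B : ZMod ℓ)) = 0 := by
      have := congrArg (Int.cast : ℤ → ZMod ℓ) hX1
      push_cast at this
      have h2 : (q₁ : ZMod ℓ) * (B : ZMod ℓ) ^ 2 = 0 := by
        linear_combination -this + ((A' : ZMod ℓ) ^ 2 + 2 * (q₁ : ZMod ℓ) * (C' : ZMod ℓ) * (D : ZMod ℓ)
          - (p₁ : ZMod ℓ) * (q₁ : ZMod ℓ) * (D : ZMod ℓ) ^ 2 - (c : ZMod ℓ) * (M' : ZMod ℓ) ^ 2) * hz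
      exact sq_zero _ ((mul_eq_zero.1 h2).resolve_left hq₁z)
    rw [ZMod.intCast_zmod_eq_zero_iff_dvd] at hB
    obtain ⟨B', rfl⟩ := hB
    -- (iv) `Y/ℓ`, then `ℓ ∣ D`
    have hY1 : 2 * (ℓ : ℤ) * A' * B' - (ℓ * p₁) * ℓ * B' ^ 2 - ℓ * C' ^ 2 + 2 * (ℓ * p₁) * C' * D
        - (ℓ * p₁ ^ 2 - q₁) * D ^ 2 = 0 := by
      have h : (ℓ : ℤ) * (2 * (ℓ : ℤ) * A' * B' - (ℓ * p₁) * ℓ * B' ^ 2 - ℓ * C' ^ 2 + 2 * (ℓ * p₁) * C' * D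
          - (ℓ * p₁ ^ 2 - q₁) * D ^ 2) = 0 := by linear_combination hY
      exact (mul_eq_zero.1 h).resolve_left hℓ0
    have hD : ((D : ZMod ℓ)) = 0 := by
      have := congrArg (Int.cast : ℤ → ZMod ℓ) hY1
      push_cast at this
      have h2 : (q₁ : ZMod ℓ) * (D : ZMod ℓ) ^ 2 = 0 := by
        linear_combination this + (-2 * (A' : ZMod ℓ) * (B' : ZMod ℓ) + (p₁ : ZMod ℓ) * ((ℓ : ℕ) : ZMod ℓ) * (B' : ZMod ℓ) ^ 2
          + (C' : ZMod ℓ) ^ 2 - 2 * (p₁ : ZMod ℓ) * (C' : ZMod ℓ) * (D : ZMod ℓ)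
          + (p₁ : ZMod ℓ) ^ 2 * (D : ZMod ℓ) ^ 2) * hz
      exact sq_zero _ ((mul_eq_zero.1 h2).resolve_left hq₁z)
    rw [ZMod.intCast_zmod_eq_zero_iff_dvd] at hD
    obtain ⟨D', rfl⟩ := hD
    -- (v) descend
    have hX'' : A' ^ 2 - (ℓ * q₁) * B' ^ 2 + 2 * (ℓ * q₁) * C' * D' - (ℓ * p₁) * (ℓ * q₁) * D' ^ 2 = c * M' ^ 2 := by
      have h : ((ℓ : ℤ) * ℓ) * (A' ^ 2 - (ℓ * q₁) * B' ^ 2 + 2 * (ℓ * q₁) * C' * D' - (ℓ * p₁) * (ℓ * q₁) * D' ^ 2)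
          = ((ℓ : ℤ) * ℓ) * (c * M' ^ 2) := by linear_combination hX
      exact mul_left_cancel₀ (mul_ne_zero hℓ0 hℓ0) h
    have hY'' : 2 * A' * B' - (ℓ * p₁) * B' ^ 2 - C' ^ 2 + 2 * (ℓ * p₁) * C' * D'
        - ((ℓ * p₁) ^ 2 - ℓ * q₁) * D' ^ 2 = 0 := by
      have h : ((ℓ : ℤ) * ℓ) * (2 * A' * B' - (ℓ * p₁) * B' ^ 2 - C' ^ 2 + 2 * (ℓ * p₁) * C' * D'
          - ((ℓ * p₁) ^ 2 - ℓ * q₁) * D' ^ 2) = 0 := by linear_combination hY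
      exact (mul_eq_zero.1 h).resolve_left (mul_ne_zero hℓ0 hℓ0)
    have hbound : M'.natAbs ≤ n := by
      have e : ((ℓ : ℤ) * M').natAbs = ℓ * M'.natAbs := by
        rw [Int.natAbs_mul, Int.natAbs_natCast]
      rw [e] at h1
      rcases Nat.lt_or_ge n M'.natAbs with hlt | hge
      · nlinarith
      · exact hge
    have hM' : M' = 0 := ih A' B' C' D' M' hbound hX'' hY''
    rw [hM', mul_zero]

/-- **No rational solutions at the Eisenstein prime** (clear denominators, `descent_of_eisenstein`). [folklore] -/
theorem rat_no_solution_of_eisenstein (p₁ q₁ c : ℤ) (ℓ : ℕ) (hℓ : ℓ.Prime) (hq₁ : ¬ (ℓ : ℤ) ∣ q₁)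
    (hc : ∀ a m : ZMod ℓ, a ^ 2 = (c : ZMod ℓ) * m ^ 2 → a = 0 ∧ m = 0) (a₀ a₁ b₀ b₁ : ℚ)
    (hX : a₀ ^ 2 - ((ℓ * q₁ : ℤ) : ℚ) * a₁ ^ 2 + 2 * ((ℓ * q₁ : ℤ) : ℚ) * b₀ * b₁
      - ((ℓ * p₁ : ℤ) : ℚ) * ((ℓ * q₁ : ℤ) : ℚ) * b₁ ^ 2 = c)
    (hY : 2 * a₀ * a₁ - ((ℓ * p₁ : ℤ) : ℚ) * a₁ ^ 2 - b₀ ^ 2 + 2 * ((ℓ * p₁ : ℤ) : ℚ) * b₀ * b₁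
      - (((ℓ * p₁ : ℤ) : ℚ) ^ 2 - ((ℓ * q₁ : ℤ) : ℚ)) * b₁ ^ 2 = 0) : False := by
  push_cast at hX hY
  set m : ℕ := a₀.den * a₁.den * b₀.den * b₁.den with hm
  have hm0 : (m : ℤ) ≠ 0 := by
    have : 0 < m := by
      rw [hm]; exact Nat.mul_pos (Nat.mul_pos (Nat.mul_pos a₀.den_pos a₁.den_pos) b₀.den_pos) b₁.den_pos
    exact_mod_cast this.ne'
  have key : ∀ (r : ℚ) (k : ℕ), ((r.num * k : ℤ) : ℚ) = r * (r.den * k : ℕ) := by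
    intro r k
    push_cast
    rw [← mul_assoc, Rat.mul_den_eq_num]
  obtain ⟨A, hA⟩ : ∃ A : ℤ, (A : ℚ) = a₀ * m :=
    ⟨a₀.num * (a₁.den * b₀.den * b₁.den : ℕ), by rw [key, hm]; push_cast; ring⟩
  obtain ⟨B, hB⟩ : ∃ B : ℤ, (B : ℚ) = a₁ * m :=
    ⟨a₁.num * (a₀.den * b₀.den * b₁.den : ℕ), by rw [key, hm]; push_cast; ring⟩
  obtain ⟨Cc, hC⟩ : ∃ Cc : ℤ, (Cc : ℚ) = b₀ * m :=
    ⟨b₀.num * (a₀.den * a₁.den * b₁.den : ℕ), by rw [key, hm]; push_cast; ring⟩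
  obtain ⟨D, hD⟩ : ∃ D : ℤ, (D : ℚ) = b₁ * m :=
    ⟨b₁.num * (a₀.den * a₁.den * b₀.den : ℕ), by rw [key, hm]; push_cast; ring⟩
  have hXZ : A ^ 2 - (ℓ * q₁) * B ^ 2 + 2 * (ℓ * q₁) * Cc * D - (ℓ * p₁) * (ℓ * q₁) * D ^ 2 = c * (m : ℤ) ^ 2 := by
    have h : (A : ℚ) ^ 2 - ((ℓ * q₁ : ℤ) : ℚ) * (B : ℚ) ^ 2 + 2 * ((ℓ * q₁ : ℤ) : ℚ) * (Cc : ℚ) * D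
        - ((ℓ * p₁ : ℤ) : ℚ) * ((ℓ * q₁ : ℤ) : ℚ) * (D : ℚ) ^ 2 = c * ((m : ℤ) : ℚ) ^ 2 := by
      rw [hA, hB, hC, hD]; push_cast; linear_combination ((m : ℚ)) ^ 2 * hX
    exact_mod_cast h
  have hYZ : 2 * A * B - (ℓ * p₁) * B ^ 2 - Cc ^ 2 + 2 * (ℓ * p₁) * Cc * D - ((ℓ * p₁) ^ 2 - ℓ * q₁) * D ^ 2 = 0 := by
    have h : 2 * (A : ℚ) * B - ((ℓ * p₁ : ℤ) : ℚ) * (B : ℚ) ^ 2 - (Cc : ℚ) ^ 2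
        + 2 * ((ℓ * p₁ : ℤ) : ℚ) * (Cc : ℚ) * D - (((ℓ * p₁ : ℤ) : ℚ) ^ 2 - ((ℓ * q₁ : ℤ) : ℚ)) * (D : ℚ) ^ 2 = 0 := by
      rw [hA, hB, hC, hD]; push_cast; linear_combination ((m : ℚ)) ^ 2 * hY
    exact_mod_cast h
  have := descent_of_eisenstein p₁ q₁ c ℓ hℓ hq₁ hc (m : ℤ).natAbs A B Cc D m le_rfl hXZ hYZ
  exact hm0 this

/-! ### §2 The certificate at the Eisenstein prime -/

/-- **Non-split criterion at the totally ramified prime.** For `R = S² + ℓp₁S + ℓq₁` (`ℓ ∤ q₁`; both carrier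
polynomials irreducible — instance arguments) and an integer `c` which is a NON-SQUARE UNIT mod `ℓ`
(`a² ≡ cm² ⇒ a ≡ m ≡ 0`): the class of `c` in `F^×/Nm_{E/F}(E^×)` is not the split class `[(-1)²] = [1]` — the
local norm symbol `(c, σ)_𝔭` at the ramified place `𝔭 ∣ ℓ` is `(c/ℓ) = -1`. [cite: Deligne1982HodgeCycles, §4 p. 30 (1) and Cor. 4.2]
[cite: Landherr1936HermitianForms] -/
theorem mk_ne_splitDiscriminantClassCM_of_eisenstein {p₁ q₁ : ℤ} {R : Polynomial ℤ} (ℓ : ℕ) (hℓ : ℓ.Prime)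
    (hR : R = X ^ 2 + C (ℓ * p₁) * X + C (ℓ * q₁)) [Fact (Irreducible (realPolyQ R))]
    [Fact (Irreducible (cmPolyQ R))] (hq₁ : ¬ (ℓ : ℤ) ∣ q₁) (c : ℤ)
    (hc : ∀ a m : ZMod ℓ, a ^ 2 = (c : ZMod ℓ) * m ^ 2 → a = 0 ∧ m = 0) (u : (realField R)ˣ)
    (hu : (u : realField R) = AdjoinRoot.of (realPolyQ R) c) :
    (QuotientGroup.mk u : cmNormResidueGroup R) ≠ splitDiscriminantClassCM R 2 := by
  intro h
  rw [splitDiscriminantClassCM, neg_one_sq] at h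
  obtain ⟨z, -, hz⟩ := exists_eq_ratCast_mul_norm_of_mk_eq (q := u) (u := 1) (c := 1)
    (by rw [Units.val_one, Rat.cast_one]) h
  rw [Rat.cast_one, one_mul] at hz
  obtain ⟨a, b, rfl⟩ := exists_eq_realToCM_add_mul_cmRoot R z
  rw [norm_coords, algebraMap_realField_eq, hu] at hz
  have hF := (realToCM R).injective hz
  obtain ⟨a₀, a₁, rfl⟩ := exists_coords_quadratic hR a
  obtain ⟨b₀, b₁, rfl⟩ := exists_coords_quadratic hR b
  rw [normForm_coords hR] at hF
  have key : AdjoinRoot.of (realPolyQ R)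
      (a₀ ^ 2 - (ℓ * q₁ : ℤ) * a₁ ^ 2 + 2 * (ℓ * q₁ : ℤ) * b₀ * b₁ - (ℓ * p₁ : ℤ) * (ℓ * q₁ : ℤ) * b₁ ^ 2 - c) +
      AdjoinRoot.of (realPolyQ R) (2 * a₀ * a₁ - (ℓ * p₁ : ℤ) * a₁ ^ 2 - b₀ ^ 2 + 2 * (ℓ * p₁ : ℤ) * b₀ * b₁
        - ((ℓ * p₁ : ℤ) ^ 2 - (ℓ * q₁ : ℤ)) * b₁ ^ 2) * AdjoinRoot.root (realPolyQ R) = 0 := by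
    rw [map_sub, sub_add_eq_add_sub, sub_eq_zero]
    exact hF.symm
  obtain ⟨hX, hY⟩ := coords_eq_zero_quadratic hR key
  exact rat_no_solution_of_eisenstein p₁ q₁ c ℓ hℓ hq₁ hc a₀ a₁ b₀ b₁ (by linear_combination hX) hY

/-! ### §3 Instance `E = ℚ(ζ₅)`: `R = S² + 5S + 5` is Eisenstein at `ℓ = 5` (`p₁ = q₁ = 1`); the classes `[c]`,
`c ≡ ±2 (mod 5)` — among them the DYADIC row `[2]` (`T = {(2), (√5)}`) and `[27]` -/

/-- **Residues mod 5**: `a² = 2m²` or `a² = 3m²` in `𝔽₅` forces `a = m = 0` (`2`, `3` are the non-squares).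
[folklore] -/
theorem sq_eq_nonsquare_mul_sq_zmod5 :
    (∀ a m : ZMod 5, a ^ 2 = 2 * m ^ 2 → a = 0 ∧ m = 0) ∧ (∀ a m : ZMod 5, a ^ 2 = 3 * m ^ 2 → a = 0 ∧ m = 0) := by
  constructor <;> decide

/-- **`[c] ≠ [1]` in `F^×/Nm_{E/F}(E^×)` for `E = ℚ(ζ₅)`, `F = ℚ(√5)`, every integer `c ≡ ±2 (mod 5)`** — the
`(√5)`-adic obstruction: census rows `[2]` (the dyadic row `T = {(2), (√5)}`, beyond the odd-prime criteria),
`[3]`, `[7]`, `[8]`, `[12]`, `[13]`, `[17]`, `[18]`, `[22]`, `[23]`, `[27]`, `[28]`, `[32]`, `[33]`, `[37]`,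
`[38]` of the `ℚ(ζ₅)` table are NON-SPLIT. [cite: Deligne1982HodgeCycles, §4 p. 30 (1) and Cor. 4.2] -/
theorem zeta5_mk_ne_splitDiscriminantClassCM_of_residue {R : Polynomial ℤ} (hR : R = X ^ 2 + C 5 * X + C 5)
    [Fact (Irreducible (realPolyQ R))] (c : ℤ) (hc : (c : ZMod 5) = 2 ∨ (c : ZMod 5) = 3)
    (u : (realField R)ˣ) (hu : (u : realField R) = AdjoinRoot.of (realPolyQ R) c) :
    (QuotientGroup.mk u : cmNormResidueGroup R) ≠ splitDiscriminantClassCM R 2 := by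
  haveI : Fact (Irreducible (cmPolyQ R)) := fact_irreducible_cmPolyQ_R5 hR
  have hR' : R = X ^ 2 + C ((5 : ℕ) * (1 : ℤ)) * X + C ((5 : ℕ) * (1 : ℤ)) := by rw [hR]; norm_num
  refine mk_ne_splitDiscriminantClassCM_of_eisenstein 5 (by norm_num) hR' (by norm_num) c ?_ u (by rw [hu])
  intro a m h
  rcases hc with h2 | h3
  · rw [h2] at h; exact sq_eq_nonsquare_mul_sq_zmod5.1 a m h
  · rw [h3] at h; exact sq_eq_nonsquare_mul_sq_zmod5.2 a m h

/-- **`[2] ≠ [1]` for `ℚ(ζ₅)`** with `R = S² + 5S + 5` LITERALLY: the FIRST non-split row `W8.ℚ(ζ₅).{(2),(√5)}`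
of the census (least representative `δ = 2`, no odd unramified obstruction) is decided in the kernel.
[cite: Deligne1982HodgeCycles, §4 p. 30 (1) and Cor. 4.2] -/
theorem zeta5_two_nonsplit :
    haveI := fact_irreducible_realPolyQ_R5 (R := X ^ 2 + C 5 * X + C 5) rfl
    ∀ u : (realField (X ^ 2 + C 5 * X + C 5))ˣ, (u : realField (X ^ 2 + C 5 * X + C 5)) = 2 →
      (QuotientGroup.mk u : cmNormResidueGroup (X ^ 2 + C 5 * X + C 5)) ≠
        splitDiscriminantClassCM (X ^ 2 + C 5 * X + C 5) 2 := by
  haveI := fact_irreducible_realPolyQ_R5 (R := X ^ 2 + C 5 * X + C 5) rfl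
  exact fun u hu => zeta5_mk_ne_splitDiscriminantClassCM_of_residue rfl 2 (Or.inl rfl) u (by rw [hu]; simp)

/-! ### §4 `[5c] = [c]`: the rows `[10]`, `[40]` (and `[15]`, `[35]`) of the `ℚ(ζ₅)` table -/

/-- **`[5c] ≠ [1]` for `E = ℚ(ζ₅)`, `c ≡ ±2 (mod 5)`**: `5 = (2σ + 5)²` is a square of `F = ℚ(√5)`, hence a norm
from `E`, so `[5c] = [c]`; census rows `[10]`, `[40]` (the last two members of the dyadic class `[2]` with
`n ≤ 40`), `[15]`, `[35]`. With gens 46–47 EVERY non-split class `n ≤ 40` of the `ℚ(ζ₅)` table of §b03.5 is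
decided in the kernel. [cite: Deligne1982HodgeCycles, §4 p. 30 (1) and Cor. 4.2] -/
theorem zeta5_mk_five_mul_ne_splitDiscriminantClassCM_of_residue {R : Polynomial ℤ}
    (hR : R = X ^ 2 + C 5 * X + C 5) [Fact (Irreducible (realPolyQ R))] (c : ℤ)
    (hc : (c : ZMod 5) = 2 ∨ (c : ZMod 5) = 3) (u : (realField R)ˣ)
    (hu : (u : realField R) = AdjoinRoot.of (realPolyQ R) (5 * c)) :
    (QuotientGroup.mk u : cmNormResidueGroup R) ≠ splitDiscriminantClassCM R 2 := by
  haveI : Fact (Irreducible (cmPolyQ R)) := fact_irreducible_cmPolyQ_R5 hR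
  have hσ := root_rel_quadratic hR
  push_cast at hσ
  -- `v = 2σ + 5`, `v² = 5`
  have hv2 : (2 * AdjoinRoot.root (realPolyQ R) + 5) ^ 2 = 5 := by linear_combination 4 * hσ
  have h5ne : (5 : realField R) ≠ 0 := by
    have h := (AdjoinRoot.of (realPolyQ R)).injective.ne (show (5 : ℚ) ≠ 0 by norm_num)
    rwa [map_ofNat, map_zero] at h
  have hv0 : (2 * AdjoinRoot.root (realPolyQ R) + 5) ≠ 0 := by
    intro h0
    apply h5ne
    rw [← hv2, h0]
    ring
  set v : (realField R)ˣ := Units.mk0 _ hv0 with hv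
  have hmem : v ^ 2 ∈ Literature.AlgebraicGeometry.Motives.normUnitsSubgroup (realField R) (cmField R) := by
    rw [← finrank_realField_cmField (R := R)]
    exact Literature.AlgebraicGeometry.Motives.pow_finrank_mem_normUnitsSubgroup _
  -- `u = (u v⁻²) · v²` and `u v⁻² = c`
  have hu' : ((u * (v ^ 2)⁻¹ : (realField R)ˣ) : realField R) = AdjoinRoot.of (realPolyQ R) c := by
    rw [Units.val_mul, Units.val_inv_eq_inv_val, Units.val_pow_eq_pow_val, hv, Units.val_mk0, hv2, hu, map_mul,
      map_ofNat]
    field_simp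
  have hmk : (QuotientGroup.mk (u * (v ^ 2)⁻¹) : cmNormResidueGroup R) = QuotientGroup.mk u :=
    QuotientGroup.mk_mul_of_mem u (inv_mem hmem)
  intro h
  exact zeta5_mk_ne_splitDiscriminantClassCM_of_residue hR c hc (u * (v ^ 2)⁻¹) hu' (by rw [hmk, h])

/-- **`[10] ≠ [1]` for `ℚ(ζ₅)`** with `R = S² + 5S + 5` LITERALLY (`10 = 5·2`, class `[2]`).
[cite: Deligne1982HodgeCycles, §4 p. 30 (1) and Cor. 4.2] -/
theorem zeta5_ten_nonsplit :
    haveI := fact_irreducible_realPolyQ_R5 (R := X ^ 2 + C 5 * X + C 5) rfl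
    ∀ u : (realField (X ^ 2 + C 5 * X + C 5))ˣ, (u : realField (X ^ 2 + C 5 * X + C 5)) = 10 →
      (QuotientGroup.mk u : cmNormResidueGroup (X ^ 2 + C 5 * X + C 5)) ≠
        splitDiscriminantClassCM (X ^ 2 + C 5 * X + C 5) 2 := by
  haveI := fact_irreducible_realPolyQ_R5 (R := X ^ 2 + C 5 * X + C 5) rfl
  exact fun u hu => zeta5_mk_five_mul_ne_splitDiscriminantClassCM_of_residue rfl 2 (Or.inl rfl) u
    (by rw [hu]; norm_num)

end Summit.HodgeConjecture.HodgeConjecture.Ring2.WeilCoverageCM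

end
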